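import Literature.NumberTheory.LFunctions.MoebiusVaughanTypeReduction
import Literature.NumberTheory.Sieve.BombieriFriedlanderIwaniecDispersionSeparation
import HarnessLib

/-!
# Separation of variables in the type-II mean square: hyperbolic ranges to base-`q` boxes (proved)

Everything in this file is PROVED (plus one plain definition). It is the second combinatorial
layer of the Mauduit–Rivat method for `μ` (after `MoebiusVaughanTypeReduction.lean`), the
discrete analogue of Mauduit–Rivat, Ann. of Math. 171 (2010), Lemme 2 ("séparation des
variables": `|∑_{N₁<n≤N₂} a_n| ≤ ∫ min(N₂−N₁, |sin πξ|⁻¹) |∑_{N₀<n≤N₃} a_n e(nξ)| dξ`,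
`∫ ≤ 2 + (2/π) log 2x`) and of the use made of it in Lemme 3 (from the hyperbolic ranges
`x/(qm) < n ≤ x/m` of Lemme 1 to the boxes `q^{ν−1} < n ≤ q^ν` of the type-II proposition), for
the MEAN-SQUARE type-II quantity `blockII` (`MoebiusVaughanTypeReduction.lean`), with the finite
Fourier expansion of an interval (`Sieve.BFI.indicator_Ioc_eq_sum_e`) in place of the integral:

* `boxII q j i c g = ∑_{q^j ≤ k < q^{j+1}} ‖∑_{q^i ≤ ℓ < q^{i+1}} c(ℓ) g(kℓ)‖²` — the box mean
  square with COMPLEX coefficients `c` (twists `b(ℓ) e(tℓ/T)` of the real coefficients appear),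
  the quantity bounded by (the Cauchy–Schwarz opening of) Mauduit–Rivat 2015, Prop. 2;
* `blockII_le_of_boxII` — for `q ≥ 2`, `‖g‖ ≤ 1`, `|b| ≤ 1`: if `boxII q j i c g ≤ U i` for
  every `1`-bounded complex `c` and every `i` with `log_q(x/q^{j+2} + 1) ≤ i ≤ log_q(x/q^j)`,
  then `blockII q x j b g ≤ (3 + log(x/q^j + 1))² · #I · ∑_{i∈I} U i` (`#I ≤ 3`,
  `card_sepRange_le`).

Proof (per `k` in the block): the `ℓ`-range of `g̃(kℓ)` is `(x/(qk), x/k] ⊆ W = (x/q^{j+2}, x/q^j]`;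
expand its indicator on `W` into `T = ⌊x/q^j⌋ + 1` additive characters `e(tℓ/T)` with
coefficients bounded by `min(N₃, 1/(2‖t/T‖))` (`Sieve.Vinogradov.norm_sum_Ioc_fourierChar_le_geomBound`),
whose average is `≤ 3 + log T` (`Sieve.BFI.sum_range_geomBound_div_le`); Cauchy–Schwarz in `t`,
sum over `k`, and split `W` into its (at most three) base-`q` blocks.

## References
* C. Mauduit, J. Rivat, Ann. of Math. 171 (2010), Lemme 2 and Lemme 3 (pp. 1601–1604).
  [MauduitRivat2010]
* C. Mauduit, J. Rivat, J. Eur. Math. Soc. 17 (2015), §6 (first display of the proof of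
  Prop. 2) and §8. [MauduitRivat2015]
-/

noncomputable section

open Finset Real
open scoped FourierTransform

namespace Literature.NumberTheory.LFunctions.MRVaughan

open Literature.NumberTheory.Sieve.Vinogradov (geomBound geomBound_nonneg geomBound_neg
  norm_sum_Ioc_fourierChar_le_geomBound norm_fourierChar)
open Literature.NumberTheory.Sieve.BFI (indicator_Ioc_eq_sum_e sum_range_geomBound_div_le)

variable {E : Type*} [NormedAddCommGroup E] [NormedSpace ℂ E]

/-- The type-II BOX mean square with complex coefficients:
`∑_{q^j ≤ k < q^{j+1}} ‖∑_{q^i ≤ ℓ < q^{i+1}} c(ℓ) g(kℓ)‖²`.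
[cite: MauduitRivat2015, Prop. 2 (proof, first display)] -/
def boxII (q j i : ℕ) (c : ℕ → ℂ) (g : ℕ → E) : ℝ :=
  ∑ k ∈ Ico (q ^ j) (q ^ (j + 1)), ‖∑ ℓ ∈ Ico (q ^ i) (q ^ (i + 1)), c ℓ • g (k * ℓ)‖ ^ 2

/-- The set of `ℓ`-blocks meeting the wide range `W = (x/q^{j+2}, x/q^j]`. [folklore] -/
def sepRange (q x j : ℕ) : Finset ℕ :=
  Icc (Nat.log q (x / q ^ (j + 2) + 1)) (Nat.log q (x / q ^ j))

/-! ### The hyperbolic range of the inner variable -/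

/-- The inner sum of `blockII` runs over `ℓ ∈ (x/(qk), x/k]`. [folklore] -/
theorem sum_smul_hypCut_eq_sum_Ioc {q x k : ℕ} (hk : 0 < k) (hq : 0 < q) (b : ℕ → ℝ) (g : ℕ → E) :
    ∑ ℓ ∈ Ioc 0 x, b ℓ • hypCut q x g (k * ℓ) =
      ∑ ℓ ∈ Ioc (x / (q * k)) (x / k), b ℓ • g (k * ℓ) := by
  have hqk : 0 < q * k := Nat.mul_pos hq hk
  rw [← sum_filter_add_sum_filter_not (Ioc 0 x) (fun ℓ => x < q * (k * ℓ) ∧ k * ℓ ≤ x)]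
  have hzero : ∑ ℓ ∈ (Ioc 0 x).filter (fun ℓ => ¬(x < q * (k * ℓ) ∧ k * ℓ ≤ x)),
      b ℓ • hypCut q x g (k * ℓ) = 0 := by
    refine sum_eq_zero fun ℓ hℓ => ?_
    rw [mem_filter] at hℓ
    rw [hypCut_apply, if_neg, smul_zero]
    intro h
    exact hℓ.2 ⟨h.1, h.2.trans le_rfl⟩
  rw [hzero, add_zero]
  have hset : (Ioc 0 x).filter (fun ℓ => x < q * (k * ℓ) ∧ k * ℓ ≤ x) = Ioc (x / (q * k)) (x / k) := by
    ext ℓ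
    rw [mem_filter, mem_Ioc, mem_Ioc, Nat.div_lt_iff_lt_mul hqk, Nat.le_div_iff_mul_le hk]
    constructor
    · rintro ⟨-, h1, h2⟩
      refine ⟨?_, by rw [mul_comm]; exact h2⟩
      calc x < q * (k * ℓ) := h1
        _ = ℓ * (q * k) := by ring
    · rintro ⟨h1, h2⟩
      have h1' : x < q * (k * ℓ) := by
        calc x < ℓ * (q * k) := h1
          _ = q * (k * ℓ) := by ring
      refine ⟨⟨?_, ?_⟩, h1', by rw [mul_comm] at h2; exact h2⟩
      · rcases Nat.eq_zero_or_pos ℓ with rfl | h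
        · simp at h1'
        · exact h
      · calc ℓ ≤ k * ℓ := Nat.le_mul_of_pos_left ℓ hk
          _ ≤ x := by rw [mul_comm] at h2; exact h2
  rw [hset]
  refine sum_congr rfl fun ℓ hℓ => ?_
  rw [hypCut_apply, if_pos]
  rw [mem_Ioc, Nat.div_lt_iff_lt_mul hqk, Nat.le_div_iff_mul_le hk] at hℓ
  constructor
  · calc x < ℓ * (q * k) := hℓ.1
      _ = q * (k * ℓ) := by ring
  · rw [mul_comm]; exact hℓ.2

/-! ### The finite Fourier expansion of a subinterval -/

/-- **Weighted Cauchy–Schwarz**: `(∑ w a)² ≤ (∑ w)(∑ w a²)` for `w ≥ 0`. [folklore] -/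
theorem sq_sum_mul_le {ι : Type*} (s : Finset ι) {w a : ι → ℝ} (hw : ∀ i ∈ s, 0 ≤ w i) :
    (∑ i ∈ s, w i * a i) ^ 2 ≤ (∑ i ∈ s, w i) * ∑ i ∈ s, w i * a i ^ 2 := by
  have h := sum_mul_sq_le_sq_mul_sq s (fun i => Real.sqrt (w i)) (fun i => Real.sqrt (w i) * a i)
  have e1 : ∑ i ∈ s, Real.sqrt (w i) * (Real.sqrt (w i) * a i) = ∑ i ∈ s, w i * a i := by
    refine sum_congr rfl fun i hi => ?_
    rw [← mul_assoc, Real.mul_self_sqrt (hw i hi)]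
  have e2 : ∑ i ∈ s, Real.sqrt (w i) ^ 2 = ∑ i ∈ s, w i :=
    sum_congr rfl fun i hi => Real.sq_sqrt (hw i hi)
  have e3 : ∑ i ∈ s, (Real.sqrt (w i) * a i) ^ 2 = ∑ i ∈ s, w i * a i ^ 2 := by
    refine sum_congr rfl fun i hi => ?_
    rw [mul_pow, Real.sq_sqrt (hw i hi)]
  rw [e1, e2, e3] at h
  exact h

/-- **Separation of a subinterval** (discrete Mauduit–Rivat 2010, Lemme 2): for
`N₀ ≤ A`, `B ≤ N₃`, `T = N₃ + 1` and any `v : ℕ → E`,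
`‖∑_{A<ℓ≤B} v(ℓ)‖ ≤ T⁻¹ ∑_{t<T} min(N₃, 1/(2‖t/T‖)) ‖∑_{N₀<ℓ≤N₃} e(tℓ/T) v(ℓ)‖`.
[cite: MauduitRivat2010, Lemme 2] -/
theorem norm_sum_Ioc_le_sep {A B N₀ N₃ : ℕ} (hA : N₀ ≤ A) (hB : B ≤ N₃) (v : ℕ → E) :
    ‖∑ ℓ ∈ Ioc A B, v ℓ‖ ≤ ((N₃ + 1 : ℕ) : ℝ)⁻¹ * ∑ t ∈ range (N₃ + 1),
      geomBound N₃ ((t : ℝ) / (N₃ + 1 : ℕ)) *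
        ‖∑ ℓ ∈ Ioc N₀ N₃, (𝐞 ((t : ℝ) * ℓ / (N₃ + 1 : ℕ)) : ℂ) • v ℓ‖ := by
  set T : ℕ := N₃ + 1 with hT
  have hTpos : 0 < T := Nat.succ_pos _
  have hTR : (0 : ℝ) < T := by exact_mod_cast hTpos
  set W := Ioc N₀ N₃ with hW
  have hsub : Ioc A B ⊆ W := fun ℓ hℓ => by
    rw [mem_Ioc] at hℓ ⊢; omega
  -- coefficients of the expansion
  set C : ℕ → ℂ := fun t => ∑ s ∈ Ioc A B, (𝐞 (-((t : ℝ) * s / T)) : ℂ) with hC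
  have hCbound : ∀ t : ℕ, ‖C t‖ ≤ geomBound N₃ ((t : ℝ) / T) := by
    intro t
    have e : C t = ∑ s ∈ Ioc A B, (𝐞 ((s : ℝ) * (-(t : ℝ) / T)) : ℂ) := by
      refine sum_congr rfl fun s _ => ?_
      congr 1; ring
    rw [e, ← geomBound_neg, neg_div]
    refine norm_sum_Ioc_fourierChar_le_geomBound _ ?_
    have : B - A ≤ N₃ := (Nat.sub_le _ _).trans hB
    exact_mod_cast this
  -- (1) rewrite the sum over `Ioc A B` as an indicator sum over `W`
  have h1 : ∑ ℓ ∈ Ioc A B, v ℓ =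
      ∑ ℓ ∈ W, (if (A : ℤ) < (ℓ : ℤ) ∧ (ℓ : ℤ) ≤ (B : ℤ) then (1 : ℂ) else 0) • v ℓ := by
    rw [← sum_subset hsub (f := fun ℓ : ℕ => (if (A : ℤ) < (ℓ : ℤ) ∧ (ℓ : ℤ) ≤ (B : ℤ) then (1 : ℂ)
      else 0) • v ℓ)]
    · refine sum_congr rfl fun ℓ hℓ => ?_
      rw [mem_Ioc] at hℓ
      rw [if_pos ⟨by exact_mod_cast hℓ.1, by exact_mod_cast hℓ.2⟩, one_smul]
    · intro ℓ _ hℓ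
      rw [mem_Ioc, not_and_or, not_lt, not_le] at hℓ
      rw [if_neg, zero_smul]
      rintro ⟨h1, h2⟩
      rcases hℓ with h | h
      · exact absurd h1 (not_lt.2 (by exact_mod_cast h))
      · exact absurd h2 (not_le.2 (by exact_mod_cast h))
  -- (2) expand the indicator (closeness `|ℓ - s| < T` inside `W`)
  have h2 : ∀ ℓ ∈ W, (if (A : ℤ) < (ℓ : ℤ) ∧ (ℓ : ℤ) ≤ (B : ℤ) then (1 : ℂ) else 0) =
      (T : ℂ)⁻¹ * ∑ t ∈ range T, (𝐞 ((t : ℝ) * (ℓ : ℤ) / T) : ℂ) * C t := by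
    intro ℓ hℓ
    refine indicator_Ioc_eq_sum_e hTpos A B (ℓ : ℤ) fun s hs => ?_
    have hs' := hsub hs
    rw [hW, mem_Ioc] at hℓ hs'
    rw [hT]
    have : |(ℓ : ℤ) - s| ≤ N₃ := by
      rw [abs_le]; constructor <;> omega
    push_cast
    linarith
  -- (3) rearrange
  have h3 : ∑ ℓ ∈ W, (if (A : ℤ) < (ℓ : ℤ) ∧ (ℓ : ℤ) ≤ (B : ℤ) then (1 : ℂ) else 0) • v ℓ =
      (T : ℂ)⁻¹ • ∑ t ∈ range T, C t • ∑ ℓ ∈ W, (𝐞 ((t : ℝ) * ℓ / T) : ℂ) • v ℓ := by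
    calc ∑ ℓ ∈ W, (if (A : ℤ) < (ℓ : ℤ) ∧ (ℓ : ℤ) ≤ (B : ℤ) then (1 : ℂ) else 0) • v ℓ
        = ∑ ℓ ∈ W, ((T : ℂ)⁻¹ * ∑ t ∈ range T, (𝐞 ((t : ℝ) * (ℓ : ℤ) / T) : ℂ) * C t) • v ℓ :=
          sum_congr rfl fun ℓ hℓ => by rw [h2 ℓ hℓ]
      _ = ∑ ℓ ∈ W, (T : ℂ)⁻¹ • ∑ t ∈ range T, ((𝐞 ((t : ℝ) * ℓ / T) : ℂ) * C t) • v ℓ := by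
          refine sum_congr rfl fun ℓ _ => ?_
          rw [mul_smul, sum_smul]
          simp only [Int.cast_natCast]
      _ = (T : ℂ)⁻¹ • ∑ t ∈ range T, C t • ∑ ℓ ∈ W, (𝐞 ((t : ℝ) * ℓ / T) : ℂ) • v ℓ := by
          rw [← smul_sum, sum_comm]
          congr 1
          refine sum_congr rfl fun t _ => ?_
          rw [smul_sum]
          refine sum_congr rfl fun ℓ _ => ?_
          rw [← mul_smul, mul_comm]
  rw [h1, h3, norm_smul, norm_inv, Complex.norm_natCast]
  gcongr
  refine (norm_sum_le _ _).trans (sum_le_sum fun t _ => ?_)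
  rw [norm_smul]
  exact mul_le_mul_of_nonneg_right (hCbound t) (norm_nonneg _)

/-- The average of the separation weights: `T⁻¹ ∑_{t<T} min(N₃, 1/(2‖t/T‖)) ≤ 3 + log T`
(`T = N₃ + 1`; Mauduit–Rivat: `∫ min(x, |sin πξ|⁻¹) dξ ≤ 2 + (2/π) log 2x`).
[cite: MauduitRivat2010, Lemme 2 (second inequality)] -/
theorem sep_weights_avg_le (N₃ : ℕ) :
    ((N₃ + 1 : ℕ) : ℝ)⁻¹ * ∑ t ∈ range (N₃ + 1), geomBound N₃ ((t : ℝ) / (N₃ + 1 : ℕ)) ≤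
      3 + Real.log ((N₃ + 1 : ℕ) : ℝ) := by
  have hTR : (0 : ℝ) < ((N₃ + 1 : ℕ) : ℝ) := by positivity
  have h := sum_range_geomBound_div_le (T := N₃ + 1) (Nat.succ_pos _) (V := (N₃ : ℝ))
    (Nat.cast_nonneg _)
  rw [inv_mul_le_iff₀ hTR]
  have hN : (N₃ : ℝ) ≤ ((N₃ + 1 : ℕ) : ℝ) := by push_cast; linarith
  have hlog : 0 ≤ Real.log ((N₃ + 1 : ℕ) : ℝ) := Real.log_nonneg (by exact_mod_cast Nat.le_add_left 1 N₃)
  nlinarith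

/-! ### Splitting the wide range into base-`q` blocks -/

omit [NormedSpace ℂ E] in
/-- `∑_{N₀<ℓ≤N₃} F(ℓ) = ∑_{i} ∑_{q^i ≤ ℓ < q^{i+1}} [ℓ ∈ (N₀,N₃]] F(ℓ)` over the blocks meeting
`(N₀, N₃]`, `N₀ = x/q^{j+2}`, `N₃ = x/q^j`. [folklore] -/
theorem sum_Ioc_eq_sum_sepRange {q x j : ℕ} (hq : 2 ≤ q) (F : ℕ → E) :
    ∑ ℓ ∈ Ioc (x / q ^ (j + 2)) (x / q ^ j), F ℓ =
      ∑ i ∈ sepRange q x j, ∑ ℓ ∈ Ico (q ^ i) (q ^ (i + 1)),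
        (if ℓ ∈ Ioc (x / q ^ (j + 2)) (x / q ^ j) then F ℓ else 0) := by
  set W := Ioc (x / q ^ (j + 2)) (x / q ^ j) with hW
  rw [← sum_fiberwise_of_maps_to (s := W) (t := sepRange q x j) (g := fun ℓ => Nat.log q ℓ)
    (fun ℓ hℓ => ?_)]
  · refine sum_congr rfl fun i _ => ?_
    rw [← sum_filter]
    congr 1
    ext ℓ
    simp only [mem_filter, mem_Ico]
    constructor
    · rintro ⟨hℓW, rfl⟩
      have hℓ0 : ℓ ≠ 0 := by
        have := (mem_Ioc.1 hℓW).1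
        exact Nat.pos_iff_ne_zero.1 ((Nat.zero_le _).trans_lt this)
      exact ⟨⟨Nat.pow_log_le_self q hℓ0, Nat.lt_pow_succ_log_self hq ℓ⟩, hℓW⟩
    · rintro ⟨⟨h1, h2⟩, hℓW⟩
      have hℓ0 : ℓ ≠ 0 := by
        have := (mem_Ioc.1 hℓW).1
        exact Nat.pos_iff_ne_zero.1 ((Nat.zero_le _).trans_lt this)
      exact ⟨hℓW, (Nat.log_eq_iff (Or.inr ⟨hq, hℓ0⟩)).2 ⟨h1, h2⟩⟩
  · rw [hW, mem_Ioc] at hℓ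
    rw [sepRange, mem_Icc]
    exact ⟨Nat.log_mono_right (Nat.succ_le_of_lt hℓ.1), Nat.log_mono_right hℓ.2⟩

/-- **At most three blocks meet the wide range**: `#sepRange ≤ 3` (`x/q^j < q²(x/q^{j+2} + 1)`).
[folklore] -/
theorem card_sepRange_le {q : ℕ} (hq : 2 ≤ q) (x j : ℕ) : (sepRange q x j).card ≤ 3 := by
  have hq0 : 0 < q := by omega
  rw [sepRange, Nat.card_Icc]
  set N₀ := x / q ^ (j + 2) with hN₀
  have hlt : x / q ^ j < (N₀ + 1) * q ^ 2 := by
    have h1 : x < (N₀ + 1) * q ^ (j + 2) := by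
      rw [hN₀, Nat.succ_mul]
      exact Nat.lt_div_mul_add (pow_pos hq0 _)
    rw [Nat.div_lt_iff_lt_mul (pow_pos hq0 _)]
    calc x < (N₀ + 1) * q ^ (j + 2) := h1
      _ = (N₀ + 1) * q ^ 2 * q ^ j := by ring
  have hlog : Nat.log q (x / q ^ j) ≤ Nat.log q (N₀ + 1) + 2 := by
    calc Nat.log q (x / q ^ j) ≤ Nat.log q ((N₀ + 1) * q ^ 2) := Nat.log_mono_right hlt.le
      _ = Nat.log q (N₀ + 1) + 2 := by
          rw [pow_two, ← mul_assoc, Nat.log_mul_base hq (Nat.mul_ne_zero (Nat.succ_ne_zero _) (by omega)),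
            Nat.log_mul_base hq (Nat.succ_ne_zero _)]
  omega

/-! ### The separation theorem for the type-II mean square -/

/-- **From hyperbolic ranges to boxes in mean square** (Mauduit–Rivat 2010, Lemme 3 through the
discrete Lemme 2, in Cauchy–Schwarz form): for `q ≥ 2`, real coefficients `|b| ≤ 1`, and bounds
`boxII q j i c g ≤ U i` valid for every `1`-bounded complex `c` and every block `i` meeting the
wide range `(x/q^{j+2}, x/q^j]`,
`blockII q x j b g ≤ (3 + log(x/q^j + 1))² · #I · ∑_{i ∈ I} U i` (`I = sepRange q x j`,
`#I ≤ 3`). [cite: MauduitRivat2010, Lemme 3] -/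
theorem blockII_le_of_boxII {q x j : ℕ} (hq : 2 ≤ q) {b : ℕ → ℝ} (hb : ∀ ℓ, |b ℓ| ≤ 1)
    (g : ℕ → E) {U : ℕ → ℝ}
    (hU : ∀ i ∈ sepRange q x j, ∀ c : ℕ → ℂ, (∀ ℓ, ‖c ℓ‖ ≤ 1) → boxII q j i c g ≤ U i) :
    blockII q x j b g ≤ (3 + Real.log ((x / q ^ j : ℕ) + 1 : ℝ)) ^ 2 * (sepRange q x j).card *
      ∑ i ∈ sepRange q x j, U i := by
  have hq0 : 0 < q := by omega
  -- notation (kept explicit to avoid rewriting under the circle coercion)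
  obtain ⟨N₃, hN₃⟩ : ∃ N₃, N₃ = x / q ^ j := ⟨_, rfl⟩
  obtain ⟨N₀, hN₀⟩ : ∃ N₀, N₀ = x / q ^ (j + 2) := ⟨_, rfl⟩
  have hTR : (0 : ℝ) < ((N₃ + 1 : ℕ) : ℝ) := by positivity
  have hw0 : ∀ t : ℕ, 0 ≤ geomBound (N₃ : ℝ) ((t : ℝ) / (N₃ + 1 : ℕ)) :=
    fun t => geomBound_nonneg (Nat.cast_nonneg _) _
  have hL0 : 0 ≤ ((N₃ + 1 : ℕ) : ℝ)⁻¹ * ∑ t ∈ range (N₃ + 1), geomBound (N₃ : ℝ) ((t : ℝ) / (N₃ + 1 : ℕ)) :=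
    mul_nonneg (inv_nonneg.2 hTR.le) (sum_nonneg fun t _ => hw0 t)
  have hLle := sep_weights_avg_le N₃
  -- the twisted coefficients
  set c : ℕ → ℕ → ℂ := fun t ℓ =>
    if ℓ ∈ Ioc N₀ N₃ then (𝐞 ((t : ℝ) * ℓ / (N₃ + 1 : ℕ)) : ℂ) * b ℓ else 0 with hc
  have hc1 : ∀ t ℓ, ‖c t ℓ‖ ≤ 1 := by
    intro t ℓ
    simp only [hc]
    split_ifs
    · rw [norm_mul, norm_fourierChar, one_mul, Complex.norm_real, Real.norm_eq_abs]
      exact hb ℓ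
    · simp
  -- sum of the bounds is nonnegative
  have hUsum : 0 ≤ ∑ i ∈ sepRange q x j, U i := by
    refine sum_nonneg fun i hi => le_trans ?_ (hU i hi (c 0) (hc1 0))
    exact sum_nonneg fun _ _ => sq_nonneg _
  -- (1) the box bound for the twisted wide sums, for each `t`
  have hbox : ∀ t : ℕ, ∑ k ∈ Ico (q ^ j) (q ^ (j + 1)),
      ‖∑ ℓ ∈ Ioc N₀ N₃, (𝐞 ((t : ℝ) * ℓ / (N₃ + 1 : ℕ)) : ℂ) • (b ℓ • g (k * ℓ))‖ ^ 2 ≤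
        ((sepRange q x j).card : ℝ) * ∑ i ∈ sepRange q x j, U i := by
    intro t
    have hsplit : ∀ k, ∑ ℓ ∈ Ioc N₀ N₃, (𝐞 ((t : ℝ) * ℓ / (N₃ + 1 : ℕ)) : ℂ) • (b ℓ • g (k * ℓ)) =
        ∑ i ∈ sepRange q x j, ∑ ℓ ∈ Ico (q ^ i) (q ^ (i + 1)), c t ℓ • g (k * ℓ) := by
      intro k
      rw [hN₀, hN₃, sum_Ioc_eq_sum_sepRange hq]
      refine sum_congr rfl fun i _ => sum_congr rfl fun ℓ _ => ?_
      simp only [hc, hN₀, hN₃]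
      split_ifs
      · rw [← Complex.coe_smul, ← mul_smul]
      · rw [zero_smul]
    calc ∑ k ∈ Ico (q ^ j) (q ^ (j + 1)),
          ‖∑ ℓ ∈ Ioc N₀ N₃, (𝐞 ((t : ℝ) * ℓ / (N₃ + 1 : ℕ)) : ℂ) • (b ℓ • g (k * ℓ))‖ ^ 2
        = ∑ k ∈ Ico (q ^ j) (q ^ (j + 1)),
            ‖∑ i ∈ sepRange q x j, ∑ ℓ ∈ Ico (q ^ i) (q ^ (i + 1)), c t ℓ • g (k * ℓ)‖ ^ 2 := by
          refine sum_congr rfl fun k _ => by rw [hsplit k]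
      _ ≤ ∑ k ∈ Ico (q ^ j) (q ^ (j + 1)), ((sepRange q x j).card : ℝ) *
            ∑ i ∈ sepRange q x j, ‖∑ ℓ ∈ Ico (q ^ i) (q ^ (i + 1)), c t ℓ • g (k * ℓ)‖ ^ 2 := by
          refine sum_le_sum fun k _ => ?_
          refine le_trans (pow_le_pow_left₀ (norm_nonneg _) (norm_sum_le _ _) 2) ?_
          exact sq_sum_le_card_mul_sum_sq
      _ = ((sepRange q x j).card : ℝ) * ∑ i ∈ sepRange q x j, boxII q j i (c t) g := by
          rw [← mul_sum, sum_comm]; rfl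
      _ ≤ ((sepRange q x j).card : ℝ) * ∑ i ∈ sepRange q x j, U i := by
          gcongr with i hi
          exact hU i hi (c t) (hc1 t)
  -- (2) the per-`k` separated bound
  have hk : ∀ k ∈ Ico (q ^ j) (q ^ (j + 1)),
      ‖∑ ℓ ∈ Ioc 0 x, b ℓ • hypCut q x g (k * ℓ)‖ ^ 2 ≤
        (((N₃ + 1 : ℕ) : ℝ)⁻¹ * ∑ t ∈ range (N₃ + 1), geomBound (N₃ : ℝ) ((t : ℝ) / (N₃ + 1 : ℕ))) *
          (((N₃ + 1 : ℕ) : ℝ)⁻¹ * ∑ t ∈ range (N₃ + 1), geomBound (N₃ : ℝ) ((t : ℝ) / (N₃ + 1 : ℕ)) *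
            ‖∑ ℓ ∈ Ioc N₀ N₃, (𝐞 ((t : ℝ) * ℓ / (N₃ + 1 : ℕ)) : ℂ) • (b ℓ • g (k * ℓ))‖ ^ 2) := by
    intro k hkI
    rw [mem_Ico] at hkI
    have hk0 : 0 < k := lt_of_lt_of_le (pow_pos hq0 j) hkI.1
    rw [sum_smul_hypCut_eq_sum_Ioc hk0 hq0 b g]
    have hA : N₀ ≤ x / (q * k) := by
      rw [hN₀]
      refine Nat.div_le_div_left ?_ (Nat.mul_pos hq0 hk0)
      calc q * k ≤ q * q ^ (j + 1) := Nat.mul_le_mul_left q hkI.2.le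
        _ = q ^ (j + 2) := by ring
    have hB : x / k ≤ N₃ := by
      rw [hN₃]; exact Nat.div_le_div_left hkI.1 (pow_pos hq0 j)
    have hsep := norm_sum_Ioc_le_sep hA hB (fun ℓ => b ℓ • g (k * ℓ))
    have hsq := pow_le_pow_left₀ (norm_nonneg _) hsep 2
    have hcs := sq_sum_mul_le (range (N₃ + 1))
      (w := fun t => geomBound (N₃ : ℝ) ((t : ℝ) / (N₃ + 1 : ℕ)))
      (a := fun t => ‖∑ ℓ ∈ Ioc N₀ N₃, (𝐞 ((t : ℝ) * ℓ / (N₃ + 1 : ℕ)) : ℂ) • (b ℓ • g (k * ℓ))‖)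
      (fun t _ => hw0 t)
    beta_reduce at hcs
    refine hsq.trans ?_
    rw [mul_pow]
    calc (((N₃ + 1 : ℕ) : ℝ)⁻¹) ^ 2 * (∑ t ∈ range (N₃ + 1),
          geomBound (N₃ : ℝ) ((t : ℝ) / (N₃ + 1 : ℕ)) *
            ‖∑ ℓ ∈ Ioc N₀ N₃, (𝐞 ((t : ℝ) * ℓ / (N₃ + 1 : ℕ)) : ℂ) • (b ℓ • g (k * ℓ))‖) ^ 2
        ≤ (((N₃ + 1 : ℕ) : ℝ)⁻¹) ^ 2 * ((∑ t ∈ range (N₃ + 1),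
            geomBound (N₃ : ℝ) ((t : ℝ) / (N₃ + 1 : ℕ))) * ∑ t ∈ range (N₃ + 1),
            geomBound (N₃ : ℝ) ((t : ℝ) / (N₃ + 1 : ℕ)) *
              ‖∑ ℓ ∈ Ioc N₀ N₃, (𝐞 ((t : ℝ) * ℓ / (N₃ + 1 : ℕ)) : ℂ) • (b ℓ • g (k * ℓ))‖ ^ 2) := by
          gcongr
      _ = _ := by ring
  -- (3) sum over `k`, swap, and use (1)
  set L : ℝ := ((N₃ + 1 : ℕ) : ℝ)⁻¹ * ∑ t ∈ range (N₃ + 1),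
    geomBound (N₃ : ℝ) ((t : ℝ) / (N₃ + 1 : ℕ)) with hL
  calc blockII q x j b g
      ≤ ∑ k ∈ Ico (q ^ j) (q ^ (j + 1)), L * (((N₃ + 1 : ℕ) : ℝ)⁻¹ * ∑ t ∈ range (N₃ + 1),
          geomBound (N₃ : ℝ) ((t : ℝ) / (N₃ + 1 : ℕ)) *
            ‖∑ ℓ ∈ Ioc N₀ N₃, (𝐞 ((t : ℝ) * ℓ / (N₃ + 1 : ℕ)) : ℂ) • (b ℓ • g (k * ℓ))‖ ^ 2) :=
        sum_le_sum hk
    _ = L * (((N₃ + 1 : ℕ) : ℝ)⁻¹ * ∑ t ∈ range (N₃ + 1),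
          geomBound (N₃ : ℝ) ((t : ℝ) / (N₃ + 1 : ℕ)) * ∑ k ∈ Ico (q ^ j) (q ^ (j + 1)),
            ‖∑ ℓ ∈ Ioc N₀ N₃, (𝐞 ((t : ℝ) * ℓ / (N₃ + 1 : ℕ)) : ℂ) • (b ℓ • g (k * ℓ))‖ ^ 2) := by
        rw [← mul_sum, ← mul_sum, sum_comm]
        congr 2
        refine sum_congr rfl fun t _ => ?_
        rw [mul_sum]
    _ ≤ L * (((N₃ + 1 : ℕ) : ℝ)⁻¹ * ∑ t ∈ range (N₃ + 1),
          geomBound (N₃ : ℝ) ((t : ℝ) / (N₃ + 1 : ℕ)) *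
            (((sepRange q x j).card : ℝ) * ∑ i ∈ sepRange q x j, U i)) := by
        gcongr with t _
        · exact hw0 t
        · exact hbox t
    _ = L * L * (((sepRange q x j).card : ℝ) * ∑ i ∈ sepRange q x j, U i) := by
        rw [hL, ← sum_mul]; ring
    _ ≤ (3 + Real.log ((N₃ + 1 : ℕ) : ℝ)) * (3 + Real.log ((N₃ + 1 : ℕ) : ℝ)) *
          (((sepRange q x j).card : ℝ) * ∑ i ∈ sepRange q x j, U i) := by
        have hI0 : 0 ≤ ((sepRange q x j).card : ℝ) * ∑ i ∈ sepRange q x j, U i :=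
          mul_nonneg (Nat.cast_nonneg _) hUsum
        gcongr
    _ = (3 + Real.log ((x / q ^ j : ℕ) + 1 : ℝ)) ^ 2 * ((sepRange q x j).card : ℝ) *
          ∑ i ∈ sepRange q x j, U i := by
        rw [hN₃]; push_cast; ring

end Literature.NumberTheory.LFunctions.MRVaughan
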